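import Mathlib.Analysis.SpecialFunctions.Pow.Real
import Mathlib.Analysis.SpecialFunctions.Sqrt
import HarnessLib

/-!
# The arithmetic core of PROPOSITION W₀ «the (4,3) window closes from below» (lane prim-rate, constants-miner 1, gen 20; CANDIDATES §GEN-20 R185, BENCH l.204 M1-W0)

Support file for the closed crux `NoHeavyLowerTail` (stmt-CriticalPhenomena-4575), majority-gluing line (C(6) and its window
`max δ < 13/256`).  PROPOSITION W₀ of the lane (paper, `prim-rate-mine-1/PROP-W0.md`): for a hub `a` and four relays `v₁ … v₄` with
`δ_i = μ(v_i ↮ a)`, `M = δ₁ = max_i δ_i` and `X = μ(at least three relays cut)`,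
  `X ≤ M + M^{3 − √3}`,  hence  `μ(H_a) ≤ δ_a + (1 − δ_a)·X ≤ δ₀·(2 − δ₀ + (1 − δ₀)·δ₀^{2 − √3}) ≤ (2 + δ₀^{2 − √3})·δ₀`,
i.e. `C(6) ≤ 2 + δ₀^{2−√3}`, which is below `min(499/243, 1 + (256/243)(1 − δ₀))` exactly when `δ₀ < (13/243)^{1/(2−√3)} ≈ 1.8·10⁻⁵`.
The percolation input is the chain of four inequalities between event probabilities
  (1) `X − δ₁ = T₁ − S₁` (exact: `T₁ = μ(v₁ attached; v₂, v₃, v₄ cut)`, `S₁ = μ(v₁ cut; at most one other relay cut)`),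
  (2) `T₁ ≤ S₁ + A₂` (the vdBHK «C-alone» row `Calone₂` of the lane's 49 linear rows, CANDIDATES §GEN-17 R135, applied on `T₁` where
      the off-hub block of `v₁` holds no other relay; `A₂ = μ(v₁ cut with a singleton off-hub block, v₂ attached, v₃ and v₄ cut)`),
  (3) `A₂ ≤ u` with `u = μ(a, v₁, v₃ pairwise disconnected)` (event inclusion),
  (4) `u^{c₃} ≤ r_a·r_{v₁}·r_{v₃}` with `c₃ = (3 + √3)/2` (ISO₃, the three-point case of the lane's THEOREM E, CANDIDATES §GEN-16 R130) and
      `r_a ≤ δ₃ ≤ M`, `r_{v₁} ≤ δ₁ = M`, `r_{v₃} ≤ δ₃ ≤ M` (event inclusions).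
THIS FILE proves the real arithmetic that turns (1)–(4) into the two displayed bounds: `iso3_cap` (`u^{c₃} ≤ M³ ⟹ u ≤ M^{3−√3}`, incl.
`3/c₃ = 3 − √3`), `window_below_core` (the chain ⟹ `X ≤ M + M^{3−√3}`), `gluingLoss_le` / `gluingLoss_le'` (the C(6)-shape bound).  The
percolation steps (1)–(4) are NOT formalised here (rows `Calone₂` and ISO₃ are paper theorems of the lane); see PROP-W0.md.  No sorries,
no definitions, no named facts. [cite: VandenbergHaggstromKahn2005, Thm. 1.3 (p. 6)]
-/

noncomputable section

namespace Summit.CriticalPhenomena.PercolationContinuityZ3.Theorems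

namespace HubOnly
namespace WindowBelow

open Real

/-- The triple isolation exponent of THEOREM E's three-point case: `c₃ = (3 + √3)/2 ≈ 2.366`. -/
theorem c3_pos : 0 < (3 + Real.sqrt 3) / 2 := by
  have h : 0 ≤ Real.sqrt 3 := Real.sqrt_nonneg 3
  linarith

/-- `3/c₃ = 3 − √3` for `c₃ = (3 + √3)/2` (since `(3 − √3)(3 + √3) = 6`). -/
theorem three_div_c3 : 3 / ((3 + Real.sqrt 3) / 2) = 3 - Real.sqrt 3 := by
  have h3 : Real.sqrt 3 * Real.sqrt 3 = 3 := Real.mul_self_sqrt (by norm_num : (0:ℝ) ≤ 3)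
  have hpos : 0 < (3 + Real.sqrt 3) / 2 := c3_pos
  rw [div_eq_iff (ne_of_gt hpos)]
  nlinarith [h3]

/-- ISO₃ cap: if `0 ≤ u`, `u ^ c₃ ≤ M ^ 3` with `0 ≤ M`, then `u ≤ M ^ (3 − √3)`.
Used with `u = μ(a, v₁, v₃ pairwise disconnected)` and `r_a r_{v₁} r_{v₃} ≤ M³`. -/
theorem iso3_cap {u M : ℝ} (hu : 0 ≤ u) (hM : 0 ≤ M)
    (hiso : u ^ ((3 + Real.sqrt 3) / 2) ≤ M ^ (3:ℝ)) : u ≤ M ^ (3 - Real.sqrt 3) := by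
  set c : ℝ := (3 + Real.sqrt 3) / 2 with hc
  have hcpos : 0 < c := c3_pos
  have hcne : c ≠ 0 := ne_of_gt hcpos
  have hinv : 0 ≤ c⁻¹ := le_of_lt (inv_pos.mpr hcpos)
  -- raise both sides of `u^c ≤ M^3` to the power `1/c`
  have h1 : (u ^ c) ^ c⁻¹ ≤ (M ^ (3:ℝ)) ^ c⁻¹ :=
    Real.rpow_le_rpow (Real.rpow_nonneg hu c) hiso hinv
  rw [Real.rpow_rpow_inv hu hcne] at h1
  rw [← Real.rpow_mul hM] at h1
  have hexp : (3:ℝ) * c⁻¹ = 3 - Real.sqrt 3 := by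
    rw [← div_eq_mul_inv]; exact three_div_c3
  rw [hexp] at h1
  exact h1

/-- The product bound feeding `iso3_cap`: `r_a ≤ M`, `r₁ ≤ M`, `r₃ ≤ M` (all non-negative) give `r_a·r₁·r₃ ≤ M ^ 3`. -/
theorem prod_three_le_cube {ra r1 r3 M : ℝ} (h0 : 0 ≤ ra) (h1 : 0 ≤ r1) (h3 : 0 ≤ r3)
    (ha : ra ≤ M) (hb : r1 ≤ M) (hd : r3 ≤ M) : ra * r1 * r3 ≤ M ^ (3:ℝ) := by
  have hM : 0 ≤ M := le_trans h0 ha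
  have hnat : M ^ (3:ℝ) = M ^ (3:ℕ) := by
    rw [show (3:ℝ) = ((3:ℕ):ℝ) by norm_num, Real.rpow_natCast]
  rw [hnat]
  have : ra * r1 * r3 ≤ M * M * M := by
    have e1 : ra * r1 ≤ M * M := mul_le_mul ha hb h1 hM
    have e2 : 0 ≤ M * M := mul_nonneg hM hM
    calc ra * r1 * r3 ≤ (M * M) * r3 := mul_le_mul_of_nonneg_right e1 h3
      _ ≤ (M * M) * M := mul_le_mul_of_nonneg_left hd e2
  simpa [pow_succ, mul_assoc] using this

/-- **PROPOSITION W₀, arithmetic core.**  From the chain (1) `X − δ₁ = T₁ − S₁`, (2) `T₁ ≤ S₁ + A₂`, (3) `A₂ ≤ u`,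
(4) `u^{c₃} ≤ r_a r₁ r₃` with `r_a, r₁, r₃ ≤ M = δ₁` (all quantities probabilities, so non-negative):  `X ≤ M + M^{3 − √3}`. -/
theorem window_below_core {X δ₁ T₁ S₁ A₂ u ra r1 r3 M : ℝ}
    (hu : 0 ≤ u) (h0 : 0 ≤ ra) (h1 : 0 ≤ r1) (h3 : 0 ≤ r3)
    (hid : X - δ₁ = T₁ - S₁) (hcal : T₁ ≤ S₁ + A₂) (hinc : A₂ ≤ u)
    (hiso : u ^ ((3 + Real.sqrt 3) / 2) ≤ ra * r1 * r3)
    (ha : ra ≤ M) (hb : r1 ≤ M) (hd : r3 ≤ M) (hM : δ₁ = M) :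
    X ≤ M + M ^ (3 - Real.sqrt 3) := by
  have hMnn : 0 ≤ M := le_trans h0 ha
  have hcube : ra * r1 * r3 ≤ M ^ (3:ℝ) := prod_three_le_cube h0 h1 h3 ha hb hd
  have hcap : u ≤ M ^ (3 - Real.sqrt 3) := iso3_cap hu hMnn (le_trans hiso hcube)
  linarith

/-- `2 − √3 > 0` and `3 − √3 = 1 + (2 − √3)`. -/
theorem two_sub_sqrt3_pos : 0 < 2 - Real.sqrt 3 := by
  have h : Real.sqrt 3 < 2 := by
    rw [show (2:ℝ) = Real.sqrt 4 by rw [show (4:ℝ) = 2^2 by norm_num, Real.sqrt_sq (by norm_num : (0:ℝ) ≤ 2)]]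
    exact Real.sqrt_lt_sqrt (by norm_num) (by norm_num)
  linarith

/-- `δ₀ ^ (3 − √3) = δ₀ · δ₀ ^ (2 − √3)` for `δ₀ ≥ 0`. -/
theorem rpow_three_sub_sqrt3 {d : ℝ} (hd : 0 ≤ d) : d ^ (3 - Real.sqrt 3) = d * d ^ (2 - Real.sqrt 3) := by
  have hsum : (1:ℝ) + (2 - Real.sqrt 3) = 3 - Real.sqrt 3 := by ring
  have hne : (1:ℝ) + (2 - Real.sqrt 3) ≠ 0 := by rw [hsum]; have := two_sub_sqrt3_pos; linarith
  rw [← hsum, Real.rpow_add' hd hne, Real.rpow_one]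

/-- **C(6)-shape bound.**  If `X ≤ M + M^{3−√3}` (W₀) with `0 ≤ M ≤ δ₀ ≤ 1`, `X ≤ 1` and `0 ≤ δ_a ≤ δ₀`, then the Harris bound
`μ(H_a) ≤ δ_a + (1 − δ_a)·X` of the lane's …MajorityGluingSixHarris is at most `δ₀·(2 − δ₀ + (1 − δ₀)·δ₀^{2−√3})`. -/
theorem gluingLoss_le {δa δ₀ X M : ℝ} (ha0 : 0 ≤ δa) (ha : δa ≤ δ₀) (hM0 : 0 ≤ M) (hM : M ≤ δ₀) (hd1 : δ₀ ≤ 1)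
    (hX1 : X ≤ 1) (hW : X ≤ M + M ^ (3 - Real.sqrt 3)) :
    δa + (1 - δa) * X ≤ δ₀ * (2 - δ₀ + (1 - δ₀) * δ₀ ^ (2 - Real.sqrt 3)) := by
  have hd0 : 0 ≤ δ₀ := le_trans ha0 ha
  -- monotone in δ_a because X ≤ 1
  have step1 : δa + (1 - δa) * X ≤ δ₀ + (1 - δ₀) * X := by nlinarith
  -- monotone in M: M^{3−√3} ≤ δ₀^{3−√3}
  have hexp : 0 ≤ 3 - Real.sqrt 3 := by have := two_sub_sqrt3_pos; linarith
  have hpow : M ^ (3 - Real.sqrt 3) ≤ δ₀ ^ (3 - Real.sqrt 3) := Real.rpow_le_rpow hM0 hM hexp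
  have step2 : X ≤ δ₀ + δ₀ ^ (3 - Real.sqrt 3) := by linarith
  have h1d : 0 ≤ 1 - δ₀ := by linarith
  have step3 : δ₀ + (1 - δ₀) * X ≤ δ₀ + (1 - δ₀) * (δ₀ + δ₀ ^ (3 - Real.sqrt 3)) := by
    have := mul_le_mul_of_nonneg_left step2 h1d; linarith
  rw [rpow_three_sub_sqrt3 hd0] at step3
  have : δ₀ + (1 - δ₀) * (δ₀ + δ₀ * δ₀ ^ (2 - Real.sqrt 3)) = δ₀ * (2 - δ₀ + (1 - δ₀) * δ₀ ^ (2 - Real.sqrt 3)) := by ring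
  linarith

/-- The simpler form `μ(H_a) ≤ (2 + δ₀^{2−√3})·δ₀`, i.e. «C(6) ≤ 2 + δ₀^{2−√3}». -/
theorem gluingLoss_le' {δa δ₀ X M : ℝ} (ha0 : 0 ≤ δa) (ha : δa ≤ δ₀) (hM0 : 0 ≤ M) (hM : M ≤ δ₀) (hd1 : δ₀ ≤ 1)
    (hX1 : X ≤ 1) (hW : X ≤ M + M ^ (3 - Real.sqrt 3)) :
    δa + (1 - δa) * X ≤ (2 + δ₀ ^ (2 - Real.sqrt 3)) * δ₀ := by
  have hd0 : 0 ≤ δ₀ := le_trans ha0 ha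
  have h := gluingLoss_le ha0 ha hM0 hM hd1 hX1 hW
  have hp : 0 ≤ δ₀ ^ (2 - Real.sqrt 3) := Real.rpow_nonneg hd0 _
  have : δ₀ * (2 - δ₀ + (1 - δ₀) * δ₀ ^ (2 - Real.sqrt 3)) ≤ (2 + δ₀ ^ (2 - Real.sqrt 3)) * δ₀ := by
    have e : (2 + δ₀ ^ (2 - Real.sqrt 3)) * δ₀ - δ₀ * (2 - δ₀ + (1 - δ₀) * δ₀ ^ (2 - Real.sqrt 3))
        = δ₀ * δ₀ * (1 + δ₀ ^ (2 - Real.sqrt 3)) := by ring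
    nlinarith [mul_nonneg (mul_nonneg hd0 hd0) (add_nonneg zero_le_one hp)]
  linarith

/-- Where W₀ beats the lane's constant `1 + (256/243)(1 − δ₀)` (= `499/243` at its largest): `2 + t ≤ 1 + (256/243)(1 − δ₀)` as soon as
`t + (256/243)·δ₀ ≤ 13/243` — stated for the abstract excess `t = δ₀^{2−√3}`; numerically this is `δ₀ < 1.795·10⁻⁵`. -/
theorem beats_vdBK_constant {δ₀ t : ℝ} (h : t + 256 / 243 * δ₀ ≤ 13 / 243) :
    2 + t ≤ 1 + 256 / 243 * (1 - δ₀) := by linarith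


/-! ### The three-row sharpening (gen 20, second half): constant `1/2`
Summing the three C-alone rows (`Calone₂ + Calone₃ + Calone₄ ≤ 0`) gives the exact bookkeeping
`3·(X − δ₁) ≤ A′ − P₁ − 3·D₁ − 2·E₂ − S″ ≤ A′`, where `A′ = A₂ + A₃ + A₄` is the total mass of the six types «v₁ cut with a singleton
off-hub block, exactly two of v₂, v₃, v₄ cut, the third attached» (the only types with a positive coefficient, `+1` each) — PROP-W0.md §2;
and the event inclusions `A₂ + A₃ ≤ u_{a v₁ v₄}`, `A₂ + A₄ ≤ u_{a v₁ v₃}`, `A₃ + A₄ ≤ u_{a v₁ v₂}` give `2A′ ≤ u₂ + u₃ + u₄` with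
`u_y := μ(a, v₁, v_y pairwise disconnected)`, each capped by ISO₃ as before.  Hence `X ≤ M + ½·M^{3−√3}` and `C(6) ≤ 2 + ½·δ₀^{2−√3}`,
below `1 + (256/243)(1 − δ₀)` for `δ₀ < 2.34·10⁻⁴`. -/

/-- **PROPOSITION W₀′ (constant ½), arithmetic core.**  From `3(X − δ₁) ≤ A′` (three C-alone rows), `2A′ ≤ u₂ + u₃ + u₄` (event inclusions)
and the three ISO₃ caps `u_y^{c₃} ≤ M³` (`r ≤ M`):  `X ≤ M + ½·M^{3−√3}`. -/
theorem window_below_core_half {X δ₁ A' u2 u3 u4 M : ℝ}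
    (hu2 : 0 ≤ u2) (hu3 : 0 ≤ u3) (hu4 : 0 ≤ u4) (hM0 : 0 ≤ M)
    (hcal3 : 3 * (X - δ₁) ≤ A') (hinc : 2 * A' ≤ u2 + u3 + u4)
    (hiso2 : u2 ^ ((3 + Real.sqrt 3) / 2) ≤ M ^ (3:ℝ)) (hiso3 : u3 ^ ((3 + Real.sqrt 3) / 2) ≤ M ^ (3:ℝ))
    (hiso4 : u4 ^ ((3 + Real.sqrt 3) / 2) ≤ M ^ (3:ℝ)) (hM : δ₁ = M) :
    X ≤ M + (1/2) * M ^ (3 - Real.sqrt 3) := by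
  have c2 := iso3_cap hu2 hM0 hiso2
  have c3 := iso3_cap hu3 hM0 hiso3
  have c4 := iso3_cap hu4 hM0 hiso4
  linarith

/-- The C(6)-shape bound with the constant ½: `μ(H_a) ≤ δ_a + (1 − δ_a)·X ≤ δ₀·(2 − δ₀ + ½(1 − δ₀)·δ₀^{2−√3}) ≤ (2 + ½·δ₀^{2−√3})·δ₀`. -/
theorem gluingLoss_le_half {δa δ₀ X M : ℝ} (ha0 : 0 ≤ δa) (ha : δa ≤ δ₀) (hM0 : 0 ≤ M) (hM : M ≤ δ₀) (hd1 : δ₀ ≤ 1)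
    (hX1 : X ≤ 1) (hW : X ≤ M + (1/2) * M ^ (3 - Real.sqrt 3)) :
    δa + (1 - δa) * X ≤ δ₀ * (2 - δ₀ + (1/2) * (1 - δ₀) * δ₀ ^ (2 - Real.sqrt 3)) ∧
    δa + (1 - δa) * X ≤ (2 + (1/2) * δ₀ ^ (2 - Real.sqrt 3)) * δ₀ := by
  have hd0 : 0 ≤ δ₀ := le_trans ha0 ha
  have step1 : δa + (1 - δa) * X ≤ δ₀ + (1 - δ₀) * X := by nlinarith
  have hexp : 0 ≤ 3 - Real.sqrt 3 := by have := two_sub_sqrt3_pos; linarith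
  have hpow : M ^ (3 - Real.sqrt 3) ≤ δ₀ ^ (3 - Real.sqrt 3) := Real.rpow_le_rpow hM0 hM hexp
  have step2 : X ≤ δ₀ + (1/2) * δ₀ ^ (3 - Real.sqrt 3) := by linarith
  have h1d : 0 ≤ 1 - δ₀ := by linarith
  have step3 : δ₀ + (1 - δ₀) * X ≤ δ₀ + (1 - δ₀) * (δ₀ + (1/2) * δ₀ ^ (3 - Real.sqrt 3)) := by
    have := mul_le_mul_of_nonneg_left step2 h1d; linarith
  rw [rpow_three_sub_sqrt3 hd0] at step3
  have hp : 0 ≤ δ₀ ^ (2 - Real.sqrt 3) := Real.rpow_nonneg hd0 _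
  have e1 : δ₀ + (1 - δ₀) * (δ₀ + (1/2) * (δ₀ * δ₀ ^ (2 - Real.sqrt 3)))
      = δ₀ * (2 - δ₀ + (1/2) * (1 - δ₀) * δ₀ ^ (2 - Real.sqrt 3)) := by ring
  constructor
  · linarith
  · have e2 : (2 + (1/2) * δ₀ ^ (2 - Real.sqrt 3)) * δ₀ - δ₀ * (2 - δ₀ + (1/2) * (1 - δ₀) * δ₀ ^ (2 - Real.sqrt 3))
        = δ₀ * δ₀ * (1 + (1/2) * δ₀ ^ (2 - Real.sqrt 3)) := by ring
    nlinarith [mul_nonneg (mul_nonneg hd0 hd0) (add_nonneg zero_le_one (mul_nonneg (by norm_num : (0:ℝ) ≤ 1/2) hp))]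

end WindowBelow
end HubOnly

end Summit.CriticalPhenomena.PercolationContinuityZ3.Theorems
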